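import Summits.BirchSwinnertonDyer.BirchSwinnertonDyer.Theorems.ByReductionTypeAtTwoMultTransportTwistedDescentFacts
import Summits.BirchSwinnertonDyer.BirchSwinnertonDyer.Theorems.ByReductionTypeAtTwoMultTransportTwistedDescentGenericSigma
import HarnessLib

/-!
# T-42 in the kernel, generic twisted descent (LXV-b): the ∀-wrappers of file `…TwistedDescentFacts` with a
# PREDICATE `R` in place of the threaded binder `W.HasMultiplicativeReductionAtPrime 2`

Cell `bsd-2adic` (run/shared/lean/pub/bsd-2adic/), seat `bsd-2adic-t42` (BRIEF-T42), GEN 29 (memo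
`t42/DESIGN-T42-ADDENDUM-33.md`, «F3a road»: Matsuno's Lemma 4.5 (i) at a GOOD ORDINARY `2` as a kernel theorem).
HONEST FRAMING: research route; THEOREMS ONLY (no `def`, no named fact, no instance); nothing booked; nothing re-keyed;
BSD is not proved by any of this. PARTITION: X5@2 GV-transport rows whose REFERENCE curve is GOOD ORDINARY at `2`
(K4ᵐ B1·O1 `MultCongruenceTransportAtTwo`; the binder `hF3a` of p744459) × p = 2 — types-the-object-of; bears_on K4 items
19922 / 19923 (`--supports stmt-BirchSwinnertonDyer-19923`).

## What

In files XIV–XXX of the multiplicative road (`hF3b`), the reduction hypothesis `W.HasMultiplicativeReductionAtPrime 2`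
of the ∀-statements `LIFT`, `LIFT₁`, `LIFT₂`, `LIFT₃`, `T2`, `δ2`, `δinf` and of the conclusion is only THREADED — it is
consumed by the two local inputs at the end of the chain (the Tate-line package at `2`), never by the wrappers. This file
re-lands the wrappers of `…TwistedDescentFacts` with an arbitrary predicate
`R : ∀ (W : WeierstrassCurve ℚ) [W.IsElliptic] [W.IsGloballyMinimal], Prop` in place of that binder (names suffixed
`_R`, `R` the first explicit argument; statements and proofs otherwise VERBATIM). Instantiated at
`R W := IsOrdinaryAt W 2` with the good-ordinary local inputs (`…TwistedDescentOrdLinePackage`, `…OrdT2Final`) the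
chain yields `Matsuno2008.lemma45i_noFiniteSubmodule_nonPrimitive_goodOrd_two` from Greenberg's Prop. 4.9; at
`R W := W.HasMultiplicativeReductionAtPrime 2` it is the original chain.

Declarations: `hF3b_of_prop49_facts_R`.

References: [GreenbergLNM1716] §4 Lemma 4.6, Prop. 4.9, Props. 4.13–4.15 (pp. 105–126); [GreenbergVatsal2000] §2 pp. 14–17;
[MilneADT2006] I Thm. 4.10, Cor. 2.3.
-/


set_option autoImplicit false
set_option linter.dupNamespace false

noncomputable section

open scoped Classical

namespace Summit.BirchSwinnertonDyer.BirchSwinnertonDyer.Theorems.MultTransportTwistedDescent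

open NumberField IsDedekindDomain Field WeierstrassCurve
  Literature.NumberTheory.EllipticCurves Literature.NumberTheory.EllipticCurves.GreenbergVatsal2000
  Literature.NumberTheory.EllipticCurves.Greenberg1999 Literature.NumberTheory.EllipticCurves.Matsuno2008
  Summit.BirchSwinnertonDyer.Rank1Residual.X5.O1
  Summit.BirchSwinnertonDyer.BirchSwinnertonDyer.Theorems.MultTransportAtTwo

/-- **`hF3b` from Greenberg's Prop. 4.9 and the finite generation of `H¹(ℚ_Σ/ℚ_∞, E[p^∞])^∨` BY NAME,
plus the generic lifting `LIFT`.** The binder `hF3b` of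
`MultTransportAtTwo.multCongruenceTransportAtTwo_of_corePrint_{nonsplit,split,all}` (VERBATIM) follows from
the Literature named facts `Greenberg1999.prop49_noFiniteSubmodule_H1Sigma` (LNM 1716 Prop. 4.9) and
`Greenberg1999.finite_dual_H1Sigma` (p. 117 L1) and the spelled hypothesis `LIFT` (for a multiplicative
`2`, `κ` cyclotomic, `γ` a topological generator, `Σ₀ ≠ ∅` odd containing the odd bad places, `X₂(E/ℚ_∞)`
f.g. torsion: the lifting (i) of file XV along
`H¹(ℚ_Σ/ℚ_∞, E[2^∞]) → ∏_{v ∣ 2} ∏_σ H¹/Kummer × ∏_{w ∣ ∞} ∏_σ H¹` holds for all but finitely many odd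
`u`; Greenberg pp. 122–124) — file XVI `hF3b_of_prop49Sigma_of_lift_R` fed by name.
[cite: GreenbergLNM1716, §4 Prop. 4.9 (p. 113), p. 117, pp. 122–125] -/
theorem hF3b_of_prop49_facts_R (R : ∀ (W : WeierstrassCurve ℚ) [W.IsElliptic] [W.IsGloballyMinimal], Prop) (h49 : prop49_noFiniteSubmodule_H1Sigma) (hfg : finite_dual_H1Sigma)
    (LIFT : ∀ (W : WeierstrassCurve ℚ) [W.IsElliptic] [W.IsGloballyMinimal],
      R W →
      ∀ (κ : ZpExtension ℚ 2) (_hκ : κ.IsCyclotomic) (γ : absoluteGaloisGroup ℚ)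
        (_hγ : κ.IsTopGenerator γ) (S₀ : Finset (HeightOneSpectrum (𝓞 ℚ)))
        (_hne : S₀.Nonempty)
        (_hS₀ : ∀ v ∈ S₀, ((2 : ℕ) : 𝓞 ℚ) ∉ v.asIdeal)
        (_hbad : ∀ v : HeightOneSpectrum (𝓞 ℚ), v ∉ S₀ → ((2 : ℕ) : 𝓞 ℚ) ∉ v.asIdeal →
          W.HasGoodReductionAt v)
        (D : W.SelmerDualData κ γ) [Module.Finite (IwasawaAlgebra 2) D.X], D.IsTorsion →
      {u : ℤ | (2 : ℤ) ∣ u - 1 ∧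
        ¬ ∀ c ∈ unramifiedOutside κ.kerSubgroup (W.geomPrimaryTorsion 2) 2
            (↑S₀ : Set (HeightOneSpectrum (𝓞 ℚ))),
        (∀ v ∈ {v : HeightOneSpectrum (𝓞 ℚ) | ((2 : ℕ) : 𝓞 ℚ) ∈ v.asIdeal}, ∀ σ : absoluteGaloisGroup ℚ,
            W.conjH1 2 κ.kerSubgroup σ (u • W.conjH1 2 κ.kerSubgroup γ c - c) ∈
              W.localKerOver 2 κ.kerSubgroup (v.adicCompletion ℚ)) →
        (∀ (w : InfinitePlace ℚ) (σ : absoluteGaloisGroup ℚ),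
            W.conjH1 2 κ.kerSubgroup σ (u • W.conjH1 2 κ.kerSubgroup γ c - c) ∈
              W.localKerOver 2 κ.kerSubgroup w.Completion) →
        ∃ c' ∈ unramifiedOutside κ.kerSubgroup (W.geomPrimaryTorsion 2) 2
            (↑S₀ : Set (HeightOneSpectrum (𝓞 ℚ))),
          u • W.conjH1 2 κ.kerSubgroup γ c' - c' = 0 ∧
          (∀ v ∈ {v : HeightOneSpectrum (𝓞 ℚ) | ((2 : ℕ) : 𝓞 ℚ) ∈ v.asIdeal},
            ∀ σ : absoluteGaloisGroup ℚ,
              W.conjH1 2 κ.kerSubgroup σ (c' - c) ∈ W.localKerOver 2 κ.kerSubgroup (v.adicCompletion ℚ)) ∧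
          (∀ (w : InfinitePlace ℚ) (σ : absoluteGaloisGroup ℚ),
              W.conjH1 2 κ.kerSubgroup σ (c' - c) ∈ W.localKerOver 2 κ.kerSubgroup w.Completion)}.Finite) :
    ∀ (W : WeierstrassCurve ℚ) [W.IsElliptic] [W.IsGloballyMinimal],
      R W →
      ∀ (κ : ZpExtension ℚ 2) (_hκ : κ.IsCyclotomic) (γ : absoluteGaloisGroup ℚ)
        (_hγ : κ.IsTopGenerator γ) (S₀ : Finset (HeightOneSpectrum (𝓞 ℚ)))
        (_hne : S₀.Nonempty)
        (_hS₀ : ∀ v ∈ S₀, ((2 : ℕ) : 𝓞 ℚ) ∉ v.asIdeal)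
        (_hbad : ∀ v : HeightOneSpectrum (𝓞 ℚ), v ∉ S₀ → ((2 : ℕ) : 𝓞 ℚ) ∉ v.asIdeal →
          W.HasGoodReductionAt v)
        (D : W.SelmerDualData κ γ) [Module.Finite (IwasawaAlgebra 2) D.X], D.IsTorsion →
        ∀ (DS : NonPrimitiveDualData W κ γ (↑S₀ : Set (HeightOneSpectrum (𝓞 ℚ))))
          (N : Submodule (IwasawaAlgebra 2) DS.X), Finite N → N = ⊥ :=
  (hF3b_of_prop49Sigma_of_lift_R (R := R)) h49 hfg LIFT

end Summit.BirchSwinnertonDyer.BirchSwinnertonDyer.Theorems.MultTransportTwistedDescent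

end
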